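import Summits.KontsevichZagierPeriods.KontsevichZagierPeriods.Theorems.SoloBlindZetaBoxChart
import HarnessLib

/-!
# `ζ(n)` inside the rules, for every `n ≥ 2`, II: Beukers' box ≡ Kontsevich's simplex, one move

The two textbook representations of `ζ(n)` (`n ≥ 2`) as a Kontsevich–Zagier period are

* the BOX `B_n = [(0,1)ⁿ, dx/(1 - x₀x₁⋯x_{n-1})]` (Beukers; `Σ_k ∫(x₀⋯x_{n-1})ᵏ = Σ_k (k+1)^{-n}`),
* the SIMPLEX `Λ_n = [{1 > t₀ > t₁ > ⋯ > t_{n-1} > 0}, dt/(t₀ t₁ ⋯ t_{n-2} (1 - t_{n-1}))]`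
  (Kontsevich's iterated-integral formula `ζ(n) = ∫ ω₀^{n-1} ω₁`; the Literature's `KZ.mzvRep [n]`).

We prove that they are KZ-EQUIVALENT BY A SINGLE `ℚ`-RATIONAL CHANGE OF VARIABLES, uniformly in
`n`: the multiplicative chart of head products
`Φ(x) = (x₀, x₀x₁, x₀x₁x₂, …, x₀⋯x_{n-1})`
maps the open box injectively onto the open ordered simplex, is polynomial over `ℚ`, has
LOWER-TRIANGULAR Jacobian with determinant `∏_{i} (x₀⋯x_{i-1}) = t₀ t₁ ⋯ t_{n-2}`, and pulls the
simplex form back to the box form: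
`dt/(t₀⋯t_{n-2}(1 - t_{n-1})) = [t₀⋯t_{n-2}]⁻¹ · (1 - x₀⋯x_{n-1})⁻¹ · |det DΦ| dx`
`= dx/(1 - x₀⋯x_{n-1})`.

Main results (`n ≥ 2` throughout):

* (Part I, `SoloBlindZetaBoxChart`: `exists_boxChart`, the chart data — semialgebraic over `ℚ`,
  derivative, injective, image EXACTLY the open ordered simplex, `|det| = ∏ᵢ headProd x i`);
* `boxZetaRep n`, `simplexZetaRep n` (the latter IS the Literature's `KZ.mzvRep [n]`, fed with
  its two proved analytic facts), both `IsRational`;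
* `kz_zeta_box_simplex : Equivalent (boxZetaRep n hn) (simplexZetaRep n hn)` — ONE move, rule (2)
  only — and the pinned form `kz_zeta_box_simplex_pinned` for arbitrary representations carrying
  these data; for `n = 2` this is the unit-square/triangle move of `SoloBlindZetaTwoSquare` again,
  now in every dimension at once;
* values, read off the Literature on either side: `boxZetaRep_value = zetaValue n`
  (`BoxIntegral.setIntegral_box_one_div_one_sub_prod_eq_zetaValue`) and
  `simplexZetaRep_value = multipleZeta [n]` (`KZ.mzvRep_value_holds`); the move gives a second,
  independent proof of `∫_{(0,1)ⁿ} dx/(1 - ∏xᵢ) = ∫_{Δ} ω₀^{n-1}ω₁`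
  (`box_integral_eq_simplex_integral`).

References: F. Beukers, *A note on the irrationality of ζ(2) and ζ(3)* (1979), §2;
M. Kontsevich, D. Zagier, *Periods* (2001), §1.1–1.2; D. Zagier, *Values of zeta functions and
their applications* (1994), §9.
-/

noncomputable section

namespace Summit.KontsevichZagierPeriods.KontsevichZagierPeriods.Theorems

open Set MeasureTheory
open Literature.ModelTheory.ExponentialFields (IsSemialgebraic isSemialgebraic_setOf_eval_pos)
open MvPolynomial (aeval X)
open Literature.NumberTheory.Transcendental
open Literature.NumberTheory.Transcendental.KZ

namespace SoloBlind

variable {n : ℕ}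

/-! ## The two representations -/

/-- `[n]` is an admissible index for `n ≥ 2`. -/
theorem isAdmissible_singleton (hn : 2 ≤ n) : MZV.IsAdmissible [n] :=
  ⟨fun i hi => by simp only [List.mem_singleton] at hi; omega, fun _ => by simpa using hn⟩

/-- **Beukers' box** `B_n = [(0,1)ⁿ, dx/(1 - x₀⋯x_{n-1})]` (`n ≥ 2`; absolute convergence is the
Literature's `BoxIntegral.integrableOn_box_one_div_one_sub_prod`). -/
def boxZetaRep (n : ℕ) (hn : 2 ≤ n) : IntegralRep n where
  domain := kzOpenBox n
  integrand := fun x => 1 / (1 - ∏ i, x i)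
  isSemialgebraic_domain := isSemialgebraic_kzOpenBox n
  isSemialgebraicFunOn_integrand :=
    (isSemialgebraicFunOn_aeval_div_aeval (isSemialgebraic_kzOpenBox n) 1 (1 - ∏ i, X i)
      (fun x hx => by simpa [map_prod] using one_sub_prod_ne_zero (by omega) hx)).congr
      fun x _ => by simp [map_prod]
  integrableOn := BoxIntegral.integrableOn_box_one_div_one_sub_prod hn

/-- **Kontsevich's simplex** `Λ_n = [{1 > t₀ > ⋯ > t_{n-1} > 0}, dt/(t₀⋯t_{n-2}(1 - t_{n-1}))]`:
the Literature's `KZ.mzvRep [n]`, fed with its two proved analytic facts, at dimension `n`. -/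
def simplexZetaRep (n : ℕ) (hn : 2 ≤ n) : IntegralRep n :=
  mzvRep [n] (isAdmissible_singleton hn) (mzvIntegrand_isSemialgebraicFunOn_holds [n])
    (mzvIntegrand_integrableOn_holds [n] (isAdmissible_singleton hn))

/-- Data of `B_n`. -/
@[simp] theorem boxZetaRep_domain (hn : 2 ≤ n) : (boxZetaRep n hn).domain = kzOpenBox n := rfl

/-- Data of `B_n`. -/
@[simp] theorem boxZetaRep_integrand (hn : 2 ≤ n) :
    (boxZetaRep n hn).integrand = fun x => 1 / (1 - ∏ i, x i) := rfl

/-- Data of `Λ_n`. -/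
theorem simplexZetaRep_domain (hn : 2 ≤ n) :
    (simplexZetaRep n hn).domain = openOrderedSimplex n := rfl

/-- Data of `Λ_n`. -/
theorem simplexZetaRep_integrand (hn : 2 ≤ n) :
    (simplexZetaRep n hn).integrand = mzvIntegrand [n] := rfl

/-- `B_n` is rational: `p = 1`, `q = 1 - ∏ Xᵢ`. -/
theorem isRational_boxZetaRep (hn : 2 ≤ n) : (boxZetaRep n hn).IsRational :=
  ⟨1, 1 - ∏ i, X i, fun x hx => by simpa [map_prod] using one_sub_prod_ne_zero (by omega) hx,
    fun x _ => by simp [map_prod]⟩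

/-- `Λ_n` is rational (the Literature's `mzvIntegrand_eq_aeval_div_aeval`). -/
theorem isRational_simplexZetaRep (hn : 2 ≤ n) : (simplexZetaRep n hn).IsRational :=
  ⟨1, _, fun _ ht => aeval_prod_ne_zero_of_mem_openOrderedSimplex [n] ht,
    fun t _ => mzvIntegrand_eq_aeval_div_aeval [n] t⟩

/-! ## The pull-back identity -/

/-- The letters of `ζ(m+1)`: `0^{m} 1`, i.e. letter `i` is `1` iff `i = m`. -/
theorem getD_binaryWord_singleton (m : ℕ) (i : Fin (m + 1)) :
    (MZV.binaryWord [m + 1]).getD i false = decide ((i : ℕ) = m) := by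
  have hw : MZV.binaryWord [m + 1] = List.replicate m false ++ [true] := by
    simp [MZV.binaryWord]
  rw [hw, List.getD_eq_getElem?_getD, List.getElem?_append]
  rcases lt_or_eq_of_le (Nat.lt_succ_iff.mp i.2) with h | h
  · simp [h, h.ne]
  · simp [h]

/-- Kontsevich's integrand for `ζ(m+1)` in coordinates:
`(∏_{i<m} 1/tᵢ) · 1/(1 - t_m)`. -/
theorem mzvIntegrand_singleton (m : ℕ) (t : Fin (m + 1) → ℝ) :
    mzvIntegrand [m + 1] t =
      (∏ i : Fin m, 1 / t (Fin.castSucc i)) * (1 / (1 - t (Fin.last m))) := by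
  show (∏ i : Fin (m + 1), mzvForm ((MZV.binaryWord [m + 1]).getD i false) (t i)) = _
  rw [Fin.prod_univ_castSucc]
  congr 1
  · refine Finset.prod_congr rfl fun i _ => ?_
    rw [getD_binaryWord_singleton]
    simp [mzvForm, Fin.val_castSucc, (Nat.ne_of_lt i.2)]
  · rw [getD_binaryWord_singleton]
    simp [mzvForm]

/-- **The pull-back identity**: on the open box,
`1/(1 - ∏xᵢ) = (Kontsevich's integrand ∘ Φ)(x) · |det DΦ(x)|`. -/
theorem box_pullback (m : ℕ) {x : Fin (m + 1) → ℝ} (hx : x ∈ kzOpenBox (m + 1)) :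
    1 / (1 - ∏ i, x i) =
      mzvIntegrand [m + 1] (boxChart (m + 1) x) * ∏ i : Fin (m + 1), headProd x i := by
  have hx0 : ∀ i, 0 < x i := fun i => (hx i).1
  have hne : ∀ k, headProd x k ≠ 0 := fun k => (headProd_pos hx0 k).ne'
  rw [mzvIntegrand_singleton, Fin.prod_univ_succ (f := fun i : Fin (m + 1) => headProd x (i : ℕ))]
  simp only [boxChart_apply, Fin.val_castSucc, Fin.val_last, Fin.val_zero, headProd_zero, one_mul,
    Fin.val_succ]
  rw [headProd_of_le x le_rfl]
  have hcancel : (∏ i : Fin m, 1 / headProd x ((i : ℕ) + 1)) * ∏ i : Fin m, headProd x ((i : ℕ) + 1)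
      = 1 := by
    rw [← Finset.prod_mul_distrib]
    exact Finset.prod_eq_one fun i _ => one_div_mul_cancel (hne _)
  calc 1 / (1 - ∏ i, x i)
      = (∏ i : Fin m, 1 / headProd x ((i : ℕ) + 1)) * (∏ i : Fin m, headProd x ((i : ℕ) + 1)) *
          (1 / (1 - ∏ i, x i)) := by rw [hcancel, one_mul]
    _ = _ := by ring

/-! ## One move -/

/-- **`ζ(n)`: Beukers' box ≡ Kontsevich's simplex by ONE change of variables** (KZ rule (2)),
for every `n ≥ 2`. -/
theorem kz_zeta_box_simplex (hn : 2 ≤ n) : Equivalent (boxZetaRep n hn) (simplexZetaRep n hn) := by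
  obtain ⟨m, rfl⟩ : ∃ m, n = m + 1 := ⟨n - 1, by omega⟩
  obtain ⟨hsa, hderiv, hinj, himage, hdet⟩ := exists_boxChart (m + 1)
  exact equivalent_of_chart hsa hderiv hinj himage hdet
    (f := fun x => 1 / (1 - ∏ i, x i)) (g := mzvIntegrand [m + 1]) (fun x hx => box_pullback m hx)
    rfl (fun _ _ => rfl) rfl (fun _ _ => rfl)

/-- The pinned form: ANY representation with the box data is KZ-equivalent to ANY representation
with the simplex data. -/
theorem kz_zeta_box_simplex_pinned (hn : 2 ≤ n) {r r' : IntegralRep n}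
    (hrd : r.domain = kzOpenBox n)
    (hri : EqOn r.integrand (fun x => 1 / (1 - ∏ i, x i)) (kzOpenBox n))
    (hr'd : r'.domain = openOrderedSimplex n)
    (hr'i : EqOn r'.integrand (mzvIntegrand [n]) (openOrderedSimplex n)) :
    Equivalent r r' := by
  obtain ⟨m, rfl⟩ : ∃ m, n = m + 1 := ⟨n - 1, by omega⟩
  obtain ⟨hsa, hderiv, hinj, himage, hdet⟩ := exists_boxChart (m + 1)
  exact equivalent_of_chart hsa hderiv hinj himage hdet
    (f := fun x => 1 / (1 - ∏ i, x i)) (g := mzvIntegrand [m + 1]) (fun x hx => box_pullback m hx)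
    hrd hri hr'd hr'i

/-! ## Values -/

/-- `value B_n = ζ(n)` (the Literature's evaluation of the box integral). -/
theorem boxZetaRep_value (hn : 2 ≤ n) : (boxZetaRep n hn).value = zetaValue n :=
  BoxIntegral.setIntegral_box_one_div_one_sub_prod_eq_zetaValue hn

/-- `value Λ_n = ζ(n)` as a multiple zeta value (Kontsevich's formula, from the Literature). -/
theorem simplexZetaRep_value (hn : 2 ≤ n) : (simplexZetaRep n hn).value = multipleZeta [n] :=
  mzvRep_value_holds [n] (isAdmissible_singleton hn) _ _

/-- The move transports values: a second proof, through the KZ calculus, that Beukers' box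
integral equals Kontsevich's simplex integral. -/
theorem box_integral_eq_simplex_integral (hn : 2 ≤ n) :
    ∫ x in kzOpenBox n, 1 / (1 - ∏ i, x i) = ∫ t in openOrderedSimplex n, mzvIntegrand [n] t := by
  have h := relations_le_ker_eval_holds (kz_zeta_box_simplex hn)
  rw [AddMonoidHom.mem_ker, map_sub, eval_of, eval_of, sub_eq_zero] at h
  exact h

/-- Hence (through the move) `multipleZeta [n] = zetaValue n`, in agreement with the Literature's
`multipleZeta_singleton` / `tsum_one_div_succ_pow_eq_zetaValue'`. -/
theorem multipleZeta_singleton_eq_zetaValue (hn : 2 ≤ n) : multipleZeta [n] = zetaValue n := by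
  rw [← simplexZetaRep_value hn, ← boxZetaRep_value hn]
  exact (box_integral_eq_simplex_integral hn).symm

end SoloBlind

end Summit.KontsevichZagierPeriods.KontsevichZagierPeriods.Theorems
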